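import Literature.Analysis.FluidPDE.PassiveScalarDiagForcedRestartGlobal
import HarnessLib

/-!
# The global weakly continuous representative of a global weak diagonal-diffusion passive
# scalar with a source, and its restarts

Analysis/FluidPDE proof-support file (everything proved). For a GLOBAL weak solution `θ` of
`∂ₜθ + u·∇θ = κ ∑ᵢ aᵢ ∂ᵢ∂ᵢθ + s` (`Torus.IsWeakScalarTransportDiagForced a κ u s θ₀ θ`: a weak solution
on `T^d × [0,T)` for every `T > 0`; DiPerna–Lions 1989, §II.1) the finite-horizon representative of
`PassiveScalarDiagForcedTrace` is upgraded to ONE field `w` on `[0,∞)`: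

* `IsWeakScalarTransportDiagForced.exists_weaklyContinuous_representative` — `w` is jointly
  measurable on `(0,∞) × T^d`, `w(t) ∈ L²` for every `t ≥ 0` with `∫ w(t)² ≤ C_T` on `[0,T]`,
  `w(t) = θ(t)` a.e. for a.e. `t > 0`, `t ↦ ∫ w(t) g` is continuous on `[0,∞)` for every
  `g ∈ L²`, the TRACE IDENTITIES `∫ w(σ) g = ∫ θ₀ g + ∫_{(0,σ]} (∫ θ (⟪u,∇g⟫ + κ ∑ᵢ aᵢ ∂ᵢ∂ᵢ g) + ∫ s g)`
  hold for every smooth `g` and EVERY `σ ≥ 0`, `w` is itself a global weak solution from `θ₀`,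
  and for EVERY `σ ≥ 0` the translate `t ↦ w(σ + t)` is a global weak solution with drift
  `u(σ + ·)`, source `s(σ + ·)` and datum `w(σ)` — the evolution property in `C([0,∞); L²_w)`
  (the pairing primitives `P_g` do not depend on the horizon, so the continuous Fourier family is
  defined on `[0,∞)` at once; the parametrised Riesz–Fischer theorem
  `Torus.exists_realField_forall_mFourierCoeff_eq` accepts horizon-dependent bounds);
* `….exists_representative_restart_natMulPeriod` — with an `L`-periodic drift and a steady source,
  `t ↦ w(nL + t)` is a global weak solution with the SAME drift and source from `w(nL)`, for every
  `n : ℕ` (cell `ad-ideate`, ROUND-11 §2.1 (T3): "`θ(nL) ∈ L²` is a datum and `t ↦ θ(nL + t)` is a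
  weak solution from it", for one representative and all `n` simultaneously).

## References

* R. J. DiPerna, P.-L. Lions, Invent. Math. 98 (1989), §II.1, (12)–(14), §II.3. [`DiPernaLions1989`]
* C. De Lellis, L. Székelyhidi Jr., Arch. Ration. Mech. Anal. 195 (2010), Lemma 7.1, App. A.
  [`DeLellisSzekelyhidi2010`]
* J. C. Robinson, J. L. Rodrigo, W. Sadowski, *The Three-Dimensional Navier–Stokes Equations*
  (CUP 2016), Thm. 4.11. [`RobinsonRodrigoSadowski2016`]
-/

noncomputable section

open _root_.MeasureTheory _root_.Set _root_.Filter _root_.Function _root_.TopologicalSpace _root_.UnitAddTorus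
open scoped ENNReal NNReal InnerProductSpace ContDiff ComplexConjugate Topology

namespace Literature.Analysis.FluidPDE

namespace Torus

open Literature.Analysis.FunctionSpaces.Torus Literature.Analysis.FunctionSpaces

variable {d : Type*} [Fintype d] [DecidableEq d]

/-! ## Tools -/

section Tools

omit [Fintype d] [DecidableEq d] in
/-- Two functions continuous on `[0,T]` that agree for a.e. `t ∈ (0,T)` agree on `[0,T]`
(`T > 0`). [folklore] -/
private theorem eqOn_Icc_of_ae_Ioo {Y : Type*} [TopologicalSpace Y] [T2Space Y] {T : ℝ}
    (hT : 0 < T) {f g : ℝ → Y} (hf : ContinuousOn f (Icc 0 T)) (hg : ContinuousOn g (Icc 0 T))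
    (h : ∀ᵐ t ∂(volume.restrict (Ioo 0 T)), f t = g t) : EqOn f g (Icc 0 T) := by
  refine Measure.eqOn_Icc_of_ae_eq (μ := volume) hT.ne ?_ hf hg
  have e : (volume : Measure ℝ).restrict (Icc 0 T) = volume.restrict (Ioo 0 T) :=
    Measure.restrict_congr_set Ioo_ae_eq_Icc.symm
  rw [e]
  exact h

omit [Fintype d] [DecidableEq d] in
/-- A function continuous on `[0,T]` which is `≤ M` for a.e. `t ∈ (0,T)` is `≤ M` on `[0,T]`. [folklore] -/
private theorem le_on_Icc_of_ae_Ioo {T : ℝ} (hT : 0 < T) {f : ℝ → ℝ} {M : ℝ}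
    (hf : ContinuousOn f (Icc 0 T)) (h : ∀ᵐ t ∂(volume.restrict (Ioo 0 T)), f t ≤ M) :
    ∀ t ∈ Icc 0 T, f t ≤ M := by
  have key := eqOn_Icc_of_ae_Ioo (Y := ℝ) hT (hf.sup continuousOn_const) continuousOn_const
    (f := fun t => max (f t) M) (g := fun _ => M) (by filter_upwards [h] with t ht; exact max_eq_right ht)
  intro t ht
  have h1 : max (f t) M = M := key ht
  exact (le_max_left _ _).trans h1.le

omit [Fintype d] [DecidableEq d] in
/-- Continuity on `[0,∞)` from continuity on every `[0,T]`. [folklore] -/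
private theorem continuousOn_Ici_of_Icc {Y : Type*} [TopologicalSpace Y] {f : ℝ → Y}
    (h : ∀ T : ℝ, 0 < T → ContinuousOn f (Icc 0 T)) : ContinuousOn f (Ici 0) := by
  intro t₀ ht₀
  have hT : 0 < t₀ + 1 := by linarith [mem_Ici.1 ht₀]
  have hc : ContinuousWithinAt f (Icc 0 (t₀ + 1)) t₀ := h (t₀ + 1) hT t₀ ⟨ht₀, by linarith⟩
  refine hc.mono_of_mem_nhdsWithin ?_
  have hIio : Iio (t₀ + 1) ∈ 𝓝 t₀ := Iio_mem_nhds (by linarith)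
  filter_upwards [self_mem_nhdsWithin, nhdsWithin_le_nhds hIio] with t ht ht'
  exact ⟨ht, (mem_Iio.1 ht').le⟩

omit [Fintype d] [DecidableEq d] in
/-- `(0,∞) = ⋃ₙ (0, n+1)`. [folklore] -/
private theorem Ioi_zero_eq_iUnion_Ioo : Ioi (0 : ℝ) = ⋃ n : ℕ, Ioo (0 : ℝ) ((n : ℝ) + 1) := by
  ext t
  simp only [mem_Ioi, mem_iUnion, mem_Ioo]
  constructor
  · intro ht
    exact ⟨⌊t⌋₊, ht, Nat.lt_floor_add_one t⟩
  · rintro ⟨n, ht, -⟩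
    exact ht

omit [DecidableEq d] in
/-- `L²` bound from a bound on the finite Fourier sums (Parseval). [folklore] -/
private theorem integral_sq_le_of_sum_sq_le {f : UnitAddTorus d → ℝ} (hf : MemLp f 2 volume)
    {c : (d → ℤ) → ℂ} (hc : ∀ k, mFourierCoeff (fun x => ((f x : ℝ) : ℂ)) k = c k) {E : ℝ}
    (hE : ∀ F : Finset (d → ℤ), ∑ k ∈ F, ‖c k‖ ^ 2 ≤ E) : ∫ x, f x ^ 2 ≤ E := by
  have hP := hasSum_sq_norm_mFourierCoeff_ofReal hf
  simp_rw [hc] at hP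
  rw [← hP.tsum_eq]
  exact hP.summable.tsum_le_of_sum_le hE

end Tools

namespace IsWeakScalarTransportDiagForced

variable {κ : ℝ} {a : d → ℝ} {u : ℝ → UnitAddTorus d → EuclideanSpace ℝ d}
  {s : ℝ → UnitAddTorus d → ℝ} {θ₀ : UnitAddTorus d → ℝ} {θ : ℝ → UnitAddTorus d → ℝ}

/-! ## The global representative -/

/-- **The `C([0,∞); L²_w)` representative of a global weak diagonal-diffusion passive scalar with a
source, its traces, and its restarts.** See the module docstring: ONE field `w` on `[0,∞)` with
`w(t) ∈ L²` (`∫ w(t)² ≤ C_T` on `[0,T]`), `w(t) = θ(t)` a.e. for a.e. `t > 0`, `t ↦ ∫ w(t) g`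
continuous on `[0,∞)` for `g ∈ L²`, the trace identities at EVERY `σ ≥ 0`, `w` a global weak
solution from `θ₀`, and `t ↦ w(σ + t)` a global weak solution from `w(σ)` with drift `u(σ + ·)`
and source `s(σ + ·)` for EVERY `σ ≥ 0` (De Lellis–Székelyhidi 2010, Lemma 7.1 / App. A, for
the class of DiPerna–Lions 1989, §II.1; evolution property, §II.3). [cite: DeLellisSzekelyhidi2010, Lemma 7.1] -/
theorem exists_weaklyContinuous_representative [Nonempty d]
    (h : IsWeakScalarTransportDiagForced a κ u s θ₀ θ) :
    ∃ w : ℝ → UnitAddTorus d → ℝ,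
      AEStronglyMeasurable (stLift w) (volume.restrict (Ioi 0 ×ˢ univ)) ∧
      (∀ t, 0 ≤ t → MemLp (w t) 2 volume) ∧
      (∀ T : ℝ, ∃ C : ℝ≥0, ∀ t ∈ Icc 0 T, ∫ x, w t x ^ 2 ≤ C) ∧
      (∀ᵐ t ∂(volume.restrict (Ioi 0)), w t =ᵐ[volume] θ t) ∧
      (∀ g : UnitAddTorus d → ℝ, MemLp g 2 volume →
        ContinuousOn (fun t => ∫ x, w t x * g x) (Ici 0)) ∧
      (∀ g : UnitAddTorus d → ℝ, IsSmooth g → ∀ σ, 0 ≤ σ →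
        ∫ x, w σ x * g x = (∫ x, θ₀ x * g x) +
          ∫ τ in Ioc 0 σ, ((∫ x, θ τ x * (⟪u τ x, gradient g x⟫_ℝ +
            κ * ∑ i, a i * FunctionSpaces.Torus.partialDeriv i (FunctionSpaces.Torus.partialDeriv i g) x)) +
            ∫ x, s τ x * g x)) ∧
      IsWeakScalarTransportDiagForced a κ u s θ₀ w ∧
      ∀ σ, 0 ≤ σ → IsWeakScalarTransportDiagForced a κ (fun t => u (σ + t)) (fun t => s (σ + t)) (w σ)
        (fun t => w (σ + t)) := by
  -- the primitive predicted by the equation for the pairing with a steady smooth field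
  set P : (UnitAddTorus d → ℝ) → ℝ → ℝ := fun g t => (∫ x, θ₀ x * g x) +
      ∫ τ in Ioc 0 t, ((∫ x, θ τ x * (⟪u τ x, gradient g x⟫_ℝ +
        κ * ∑ i, a i * FunctionSpaces.Torus.partialDeriv i (FunctionSpaces.Torus.partialDeriv i g) x)) + ∫ x, s τ x * g x) with hP
  have hPc : ∀ {g : UnitAddTorus d → ℝ}, IsSmooth g → ∀ T, 0 < T → ContinuousOn (P g) (Icc 0 T) :=
    fun hg T hT => by rw [hP]; exact (h T hT).continuousOn_pairingPrimitive hg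
  have hPae : ∀ {g : UnitAddTorus d → ℝ}, IsSmooth g → ∀ T, 0 < T →
      ∀ᵐ t ∂(volume.restrict (Ioo 0 T)), ∫ x, θ t x * g x = P g t :=
    fun hg T hT => by rw [hP]; exact (h T hT).ae_integral_mul_eq hg
  -- the coefficient family on `[0,∞)`
  set c : ℝ → (d → ℤ) → ℂ := fun t k => ((P (reTrigPoly {-k} fun _ => (1 : ℂ)) t : ℝ) : ℂ) +
      ((P (reTrigPoly {-k} fun _ => -Complex.I) t : ℝ) : ℂ) * Complex.I with hc
  have hccT : ∀ k, ∀ T, 0 < T → ContinuousOn (fun t => c t k) (Icc 0 T) := fun k T hT => by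
    simp only [hc]
    exact (Complex.continuous_ofReal.comp_continuousOn (hPc (isSmooth_reTrigPoly _ _) T hT)).add
      ((Complex.continuous_ofReal.comp_continuousOn (hPc (isSmooth_reTrigPoly _ _) T hT)).mul
        continuousOn_const)
  have hcc : ∀ k, ContinuousOn (fun t => c t k) (Ici 0) := fun k => continuousOn_Ici_of_Icc (hccT k)
  -- identification with the Fourier coefficients of the slices, for a.e. `t ∈ (0,T)`, every `T`
  have hidT : ∀ T, 0 < T → ∀ᵐ t ∂(volume.restrict (Ioo 0 T)), ∀ k,
      c t k = mFourierCoeff (fun x => ((θ t x : ℝ) : ℂ)) k := by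
    intro T hT
    have hA : ∀ᵐ t ∂(volume.restrict (Ioo 0 T)), ∀ k : d → ℤ,
        ∫ x, θ t x * reTrigPoly {-k} (fun _ => (1 : ℂ)) x = P (reTrigPoly {-k} fun _ => (1 : ℂ)) t :=
      ae_all_iff.2 fun k => hPae (isSmooth_reTrigPoly _ _) T hT
    have hB : ∀ᵐ t ∂(volume.restrict (Ioo 0 T)), ∀ k : d → ℤ,
        ∫ x, θ t x * reTrigPoly {-k} (fun _ => -Complex.I) x = P (reTrigPoly {-k} fun _ => -Complex.I) t :=
      ae_all_iff.2 fun k => hPae (isSmooth_reTrigPoly _ _) T hT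
    filter_upwards [hA, hB, (h T hT).ae_memLp_two] with t htA htB htm k
    have hI : Integrable (θ t) volume := htm.integrable one_le_two
    simp only [hc]
    rw [← htA k, ← htB k, ← re_mFourierCoeff_ofReal hI k, ← im_mFourierCoeff_ofReal hI k]
    exact Complex.re_add_im _
  -- per-horizon Bessel bounds, for every `t ∈ [0,T]`
  have hsumT : ∀ T, 0 < T → ∃ C : ℝ≥0, ∀ t ∈ Icc 0 T, ∀ F : Finset (d → ℤ), ∑ k ∈ F, ‖c t k‖ ^ 2 ≤ (C : ℝ) := by
    intro T hT
    obtain ⟨C, hC⟩ := (h T hT).ae_lintegral_sq_le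
    have hbd : ∀ᵐ t ∂(volume.restrict (Ioo 0 T)), ∫ x, θ t x ^ 2 ≤ (C : ℝ) := by
      filter_upwards [hC, (h T hT).ae_memLp_two] with t ht hm
      rw [lintegral_enorm_sq_eq_ofReal_sq hm, ← ENNReal.ofReal_coe_nnreal] at ht
      exact (ENNReal.ofReal_le_ofReal_iff C.coe_nonneg).1 ht
    refine ⟨C, fun t ht F => ?_⟩
    refine le_on_Icc_of_ae_Ioo hT (f := fun t => ∑ k ∈ F, ‖c t k‖ ^ 2)
      (continuousOn_finsetSum _ fun k _ => ((hccT k T hT).norm).pow 2) ?_ t ht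
    filter_upwards [hidT T hT, (h T hT).ae_memLp_two, hbd] with τ hτ hτm hτb
    have e : ∑ k ∈ F, ‖c τ k‖ ^ 2 = ∑ k ∈ F, ‖mFourierCoeff (fun x => ((θ τ x : ℝ) : ℂ)) k‖ ^ 2 :=
      Finset.sum_congr rfl fun k _ => by rw [hτ k]
    show ∑ k ∈ F, ‖c τ k‖ ^ 2 ≤ _
    rw [e]
    exact (sum_le_hasSum F (fun k _ => sq_nonneg _) (hasSum_sq_norm_mFourierCoeff_ofReal hτm)).trans hτb
  choose! Cb hCb using hsumT
  -- the reality condition, for every `t ≥ 0`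
  have hsym : ∀ t, 0 ≤ t → ∀ k, c t (-k) = conj (c t k) := by
    intro t ht k
    have hT : 0 < t + 1 := by linarith
    refine eqOn_Icc_of_ae_Ioo (Y := ℂ) hT (f := fun t => c t (-k)) (g := fun t => conj (c t k))
      (hccT (-k) _ hT) (Complex.continuous_conj.comp_continuousOn (hccT k _ hT)) ?_ ⟨ht, by linarith⟩
    filter_upwards [hidT _ hT] with τ hτ
    rw [hτ (-k), hτ k]
    exact isConjSymmScalar_mFourierCoeff (θ τ) k
  -- the Riesz–Fischer representative (vector form with horizon-dependent bounds, one coordinate)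
  have hmeas : ∀ k, AEStronglyMeasurable (fun t => embedCoeff c t k) (volume.restrict (Ioi 0)) := by
    intro k
    have hck : ContinuousOn (fun t => embedCoeff c t k) (Ioi 0) :=
      ((hcc k).mono Ioi_subset_Ici_self).smul continuousOn_const
    exact hck.aestronglyMeasurable measurableSet_Ioi
  have hbound : ∀ T : ℝ, ∃ K : ℝ≥0∞, K ≠ ⊤ ∧ ∀ t ∈ Icc 0 T, ∑' k, ‖embedCoeff c t k‖ₑ ^ 2 ≤ K := by
    intro T
    have hT' : 0 < max T 1 := lt_of_lt_of_le one_pos (le_max_right _ _)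
    refine ⟨ENNReal.ofReal (Cb (max T 1)), ENNReal.ofReal_ne_top, fun t ht => ?_⟩
    have ht' : t ∈ Icc 0 (max T 1) := ⟨ht.1, ht.2.trans (le_max_left _ _)⟩
    refine ENNReal.summable.tsum_le_of_sum_le fun F => ?_
    have h1 : ∑ k ∈ F, ‖embedCoeff c t k‖ₑ ^ 2 = ENNReal.ofReal (∑ k ∈ F, ‖c t k‖ ^ 2) := by
      rw [ENNReal.ofReal_sum_of_nonneg fun k _ => sq_nonneg _]
      refine Finset.sum_congr rfl fun k _ => ?_
      rw [← ofReal_norm, norm_embedCoeff, ENNReal.ofReal_pow (norm_nonneg _)]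
    rw [h1]
    exact ENNReal.ofReal_le_ofReal (hCb _ hT' t ht' F)
  obtain ⟨v, hvm, hv⟩ := exists_realField_forall_mFourierCoeff_eq hmeas hbound
    fun t ht => isConjSymm_embedCoeff (hsym t ht)
  set i₀ : d := Classical.arbitrary d with hi₀
  set w : ℝ → UnitAddTorus d → ℝ := fun t x => v t x i₀ with hw_def
  have hwm : AEStronglyMeasurable (stLift w) (volume.restrict (Ioi 0 ×ˢ univ)) :=
    (EuclideanSpace.proj i₀ : EuclideanSpace ℝ d →L[ℝ] ℝ).continuous.comp_aestronglyMeasurable hvm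
  have hw2 : ∀ t, 0 ≤ t → MemLp (w t) 2 volume := fun t ht =>
    (EuclideanSpace.proj i₀ : EuclideanSpace ℝ d →L[ℝ] ℝ).comp_memLp' (hv t ht).1
  have hwc : ∀ t, 0 ≤ t → ∀ k, mFourierCoeff (fun x => ((w t x : ℝ) : ℂ)) k = c t k := by
    intro t ht k
    have h' := congrArg (fun z : EuclideanSpace ℂ d => z i₀) ((hv t ht).2 k)
    have hint : Integrable (EuclideanSpace.complexify ∘ v t) volume :=
      EuclideanSpace.complexify.toContinuousLinearMap.integrable_comp ((hv t ht).1.integrable one_le_two)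
    simp only [mFourierCoeff_apply_euclidean hint, Function.comp_apply, EuclideanSpace.complexify_apply,
      embedCoeff, PiLp.smul_apply, smul_eq_mul] at h'
    simpa [hi₀] using h'
  -- `L²` bounds on `[0,T]`
  have hwsq : ∀ T : ℝ, ∀ t ∈ Icc 0 T, ∫ x, w t x ^ 2 ≤ (Cb (max T 1) : ℝ) := fun T t ht =>
    integral_sq_le_of_sum_sq_le (hw2 t ht.1) (hwc t ht.1)
      (hCb _ (lt_of_lt_of_le one_pos (le_max_right _ _)) t ⟨ht.1, ht.2.trans (le_max_left _ _)⟩)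
  -- a.e. identification with `θ` on `(0,∞)`
  have haeT : ∀ T, 0 < T → ∀ᵐ t ∂(volume.restrict (Ioo 0 T)), w t =ᵐ[volume] θ t := by
    intro T hT
    filter_upwards [hidT T hT, (h T hT).ae_memLp_two, ae_restrict_mem measurableSet_Ioo] with t ht htm htI
    have ht0 : 0 ≤ t := htI.1.le
    refine ae_eq_of_forall_mFourierCoeff_ofReal_eq ((hw2 t ht0).integrable one_le_two)
      (htm.integrable one_le_two) fun k => ?_
    rw [hwc t ht0 k]
    exact ht k
  have hae : ∀ᵐ t ∂(volume.restrict (Ioi 0)), w t =ᵐ[volume] θ t := by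
    rw [Ioi_zero_eq_iUnion_Ioo, ae_restrict_iUnion_iff]
    intro n
    exact haeT _ (by positivity)
  -- weak continuity on `[0,∞)`
  have hwcont : ∀ g : UnitAddTorus d → ℝ, MemLp g 2 volume →
      ContinuousOn (fun t => ∫ x, w t x * g x) (Ici 0) := fun g hg =>
    continuousOn_Ici_of_Icc fun T hT =>
      continuousOn_integral_mul_of_coeff (S := Icc 0 T) (c := c) (fun k => hccT k T hT)
        (fun t ht => hw2 t ht.1) (fun t ht k => hwc t ht.1 k) (fun t ht => hwsq T t ht) hg
  -- the trace identities at every `σ ≥ 0`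
  have htr : ∀ g : UnitAddTorus d → ℝ, IsSmooth g → ∀ σ, 0 ≤ σ → ∫ x, w σ x * g x = P g σ := by
    intro g hg σ hσ
    have hT : 0 < σ + 1 := by linarith
    have hEq : EqOn (fun t => ∫ x, w t x * g x) (P g) (Icc 0 (σ + 1)) := by
      refine eqOn_Icc_of_ae_Ioo (Y := ℝ) hT ((hwcont g (hg.memLp 2)).mono Icc_subset_Ici_self)
        (hPc hg _ hT) ?_
      filter_upwards [haeT _ hT, hPae hg _ hT] with t ht htP
      rw [← htP]
      exact integral_congr_ae (ht.mono fun x hx => by simp only [hx])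
    exact hEq ⟨hσ, by linarith⟩
  -- `w` is a global weak solution
  have hwsol : IsWeakScalarTransportDiagForced a κ u s θ₀ w := by
    intro T hT
    refine (h T hT).congr_ae_slice ?_ (haeT T hT)
    exact hwm.mono_measure (Measure.restrict_mono_set _ (prod_mono Ioo_subset_Ioi_self le_rfl))
  refine ⟨w, hwm, hw2, fun T => ⟨Cb (max T 1), hwsq T⟩, hae, hwcont, fun g hg σ hσ => ?_, hwsol,
    fun σ hσ => hwsol.translate hσ fun g hg => ?_⟩
  · have := htr g hg σ hσ
    simpa only [hP] using this
  · -- the trace identities of `w` at `σ`, with `w` (`= θ` a.e.) inside the time integrals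
    have key := htr g hg σ hσ
    simp only [hP] at key
    rw [key]
    congr 1
    refine integral_congr_ae ?_
    have hT : 0 < σ + 1 := by linarith
    filter_upwards [ae_restrict_of_ae_restrict_of_subset (Ioc_subset_Ioo_right (by linarith : σ < σ + 1))
      (haeT _ hT)] with τ hτ
    congr 1
    exact integral_congr_ae (hτ.mono fun x hx => by simp only [hx])

/-- **One representative, all integer periods.** For an `L`-periodic drift (`L ≥ 0`, on `t ≥ 0`)
and a steady source, the global representative `w` of a global weak solution satisfies: `w` is a
global weak solution from `θ₀`, `w(t) = θ(t)` a.e. for a.e. `t > 0`, and for EVERY `n : ℕ` the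
translate `t ↦ w(nL + t)` is a global weak solution with the SAME drift and source from the `L²`
datum `w(nL)` (ROUND-11 §2.1 (T3) of cell `ad-ideate`, all `n` at once). [cite: DiPernaLions1989, §II.1 (12)–(14)] -/
theorem exists_representative_restart_natMulPeriod [Nonempty d] {S : UnitAddTorus d → ℝ} {L : ℝ}
    (hL : 0 ≤ L) (hu : ∀ t : ℝ, 0 ≤ t → u (t + L) = u t)
    (h : IsWeakScalarTransportDiagForced a κ u (fun _ => S) θ₀ θ) :
    ∃ w : ℝ → UnitAddTorus d → ℝ,
      AEStronglyMeasurable (stLift w) (volume.restrict (Ioi 0 ×ˢ univ)) ∧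
      (∀ t, 0 ≤ t → MemLp (w t) 2 volume) ∧
      (∀ᵐ t ∂(volume.restrict (Ioi 0)), w t =ᵐ[volume] θ t) ∧
      (∀ g : UnitAddTorus d → ℝ, MemLp g 2 volume →
        ContinuousOn (fun t => ∫ x, w t x * g x) (Ici 0)) ∧
      IsWeakScalarTransportDiagForced a κ u (fun _ => S) θ₀ w ∧
      ∀ n : ℕ, IsWeakScalarTransportDiagForced a κ u (fun _ => S) (w ((n : ℝ) * L))
        (fun t => w ((n : ℝ) * L + t)) := by
  obtain ⟨w, hwm, hw2, -, hae, hwc, -, hwsol, hrest⟩ := h.exists_weaklyContinuous_representative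
  refine ⟨w, hwm, hw2, hae, hwc, hwsol, fun n => ?_⟩
  intro T' hT'
  have key := hrest ((n : ℝ) * L) (by positivity) T' hT'
  exact (IsWeakScalarTransportDiagForcedOn.intPhase_iff_of_steady (T := T') (a := a) (κ := κ)
    (θ₀ := w ((n : ℝ) * L)) (θ := fun t => w ((n : ℝ) * L + t)) hL hu n).1 key

end IsWeakScalarTransportDiagForced

end Torus

end Literature.Analysis.FluidPDE

end
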